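import Summits.ResolutionOfSingularities.ResolutionOfSingularities.Theorems.PurelyInseparableDim4ResConeSatLocated
import HarnessLib
import HarnessLib.Audit.Tags

/-!
# Purely inseparable four-folds — the TAME CONE AT A CONSTANT-`d` STEP, VI: (NO-YOUNG-CORNER) — with a
# rank-`≤ 2` polar kernel, two consecutive satellite steps LOSE the grandparent exceptional divisor

[OURS · counted 0 · cell `res-dim4-pi` · desk WORD #66 (2) (K2(p) lower-band lane, owner p-12 g2) · seat
res-dim4-p-5 g2 · K lane crit-4 g2 (K-A4).]  Nothing here proves K2(p), `NoIsolatedTrap p p` or resolution of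
singularities in dimension ≥ 4 / characteristic `p`.

Setting (`…ResCone*`): THREE consecutive shade-keeping point steps in the band,
`s₀ →(j₀, b₀) s₁ →(j₁, b₁) s₂ →(j₂, b₂) s₃`, read in charts: step `m` creates the exceptional divisor `E_m`
(`= {x_{j_m} = 0}` downstream while the charts avoid `j_m`) and moves to the near point of direction
`v_m = e_{j_m} + b_m`; the step `m + 1` is a SATELLITE of step `m` when `j_{m+1} ≠ j_m ∧ (b_{m+1})_{j_m} = 0` (its centre
lies on the strict transform of `E_m`).  Polar kernels `V_m = resVertex s_m`, `e_G = finrank V_m`.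

With `e_G(s₀) ≤ 2` ONLY (no constancy of `e_G` needed) the line `V₀ ∩ H_{j₀}` controls two stages (SAT-LOCATED,
p670701: `V₁ ∩ H_{j₀} ⊆ V₀ ∩ H_{j₀}` and `V₂ ∩ H_{j₁} ⊆ V₁ ∩ H_{j₁}`):

* **`direction_apply_ne_zero_of_satellite_satellite`** (NO-YOUNG-CORNER) — satellite(1) and satellite(2) force
  `(v₂)_{j₀} ≠ 0`: the fourth centre lies on `E₁′ ∩ E₂` but OFF the strict transform of `E₀` — two consecutive
  satellite steps lose the grandparent divisor, there is no young triple corner.  Proof: `v₁ ∈ V₁ ∩ H_{j₀} ⊆ V₀ ∩ H_{j₀}`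
  (SAT-LOCATED), a space of rank `≤ 1`; `v₂ ∈ V₂ ∩ H_{j₁} ⊆ V₁` (SAT-LOCATED again); were `(v₂)_{j₀} = 0` too, `v₂` would be
  a multiple `c • v₁`, and reading the `j₁`-coordinate gives `c = 0`, `v₂ = 0`;
* **`apply_ne_zero_of_satellite_satellite`** — the same in chart-point form: `j₂ ≠ j₀ → b₂ j₀ ≠ 0`;
* **`resVertex_step_eq_span_of_satellite_satellite`** — if moreover `e_G(s₁) ≤ 2`, the middle polar kernel
  is the plane SPANNED by the two consecutive satellite directions, `V₁ = K v₁ ⊔ K v₂` (`v₁, v₂ ∈ V₁` are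
  independent: `(v₁)_{j₁} = 1`, `(v₂)_{j₁} = 0`, `v₂ ≠ 0`).

Reading for idea-4 I-4-7's ledger classes at `e_G ≡ 2` (any `p`, any `d`): along such a stretch the YOUNG boundary
through the centre is at most `{E_k, E'_{k-1}}`.
[cite: CossartJannsenSaito2020, Thm. 3.10(4), Thm. 3.14, Thm. 9.3]
bears_on: LADDER-RESOLUTION:D157-DOOR2 (res-dim4-pi · K2(p) = `RidgeBudget.NoAboveFloorTrap p p`, lower band).
Supports stmt-ResolutionOfSingularities-16155 (helper).
-/

set_option linter.dupNamespace false -- mandated namespace of this single-conjunct summit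

noncomputable section

namespace Summit.ResolutionOfSingularities.ResolutionOfSingularities.Theorems.PIDim4

namespace ResCone

open MvPolynomial Finset
open Literature.AlgebraicGeometry.Resolution
open Literature.AlgebraicGeometry.Resolution.CentreBlowup
open Literature.AlgebraicGeometry.Resolution.Hauser2010
open Literature.AlgebraicGeometry.Resolution.HauserPerlega2019
open PointBlowup (polarMap additiveSubspace direction)

variable {K : Type} [Field K]

section YoungBoundary

variable [DecidableEq K]

/-- Rank-one rigidity: in the line `resVertex s₀ ⊓ H_{j₀}` (rank `≤ 1` when `e_G(s₀) ≤ 2` and the first step is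
shade-keeping), a vector `w` with `w_{j₀} = 0` lying in `resVertex s₁` is a multiple of the satellite direction `v₁`.
[OURS] [cite: CossartJannsenSaito2020, Thm. 3.14] -/
theorem eq_smul_direction_of_mem_resVertex_step {q : ℕ} {j₀ j₁ : Fin 4} {b₀ b₁ : Fin 4 → K} (hb₀ : b₀ j₀ = 0)
    (hb₁ : b₁ j₁ = 0) {s : State K} {o₀ o₁ : ℕ} (ho₀ : ordZero s.F = o₀)
    (hr₀ : ∀ d ∈ s.F.support, s.r ≤ d) (hqo₀ : q < o₀) (ho₀2 : o₀ < 2 * q)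
    (heq₀ : (CentreBlowup.step q Finset.univ j₀ b₀ s).shade = s.shade)
    (ho₁ : ordZero (CentreBlowup.step q Finset.univ j₀ b₀ s).F = o₁)
    (hr₁ : ∀ d ∈ (CentreBlowup.step q Finset.univ j₀ b₀ s).F.support,
      (CentreBlowup.step q Finset.univ j₀ b₀ s).r ≤ d)
    (hqo₁ : q < o₁) (ho₁2 : o₁ < 2 * q)
    (heq₁ : (CentreBlowup.step q Finset.univ j₁ b₁ (CentreBlowup.step q Finset.univ j₀ b₀ s)).shade =
      (CentreBlowup.step q Finset.univ j₀ b₀ s).shade)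
    (hsat₁ : j₁ ≠ j₀ ∧ b₁ j₀ = 0) (he : Module.finrank K (resVertex s) ≤ 2)
    {w : Fin 4 → K} (hw : w ∈ resVertex (CentreBlowup.step q Finset.univ j₀ b₀ s)) (hwj : w j₀ = 0) :
    ∃ c : K, w = c • direction j₁ b₁ := by
  -- the line `L = resVertex s ⊓ H_{j₀}` has rank `≤ 1`
  have hL : Module.finrank K ↥(resVertex s ⊓ hyperplane j₀) ≤ 1 := by
    have h := finrank_resVertex_inf_hyperplane_add_one j₀ hb₀ ho₀ hr₀ hqo₀ ho₀2 heq₀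
    omega
  -- `v₁ ∈ L` (SAT-LOCATED) and `w ∈ L` (new vertex cut by `H_{j₀}` inside the old vertex)
  have hv₁ := direction_mem_resVertex_of_satellite hb₀ hb₁ ho₀ hr₀ hqo₀ ho₀2 heq₀ ho₁ hr₁ hqo₁ ho₁2 heq₁ hsat₁
  have hwL : w ∈ resVertex s ⊓ hyperplane j₀ :=
    resVertex_step_inf_hyperplane_le_resVertex j₀ hb₀ ho₀ hr₀ hqo₀ ho₀2 heq₀
      (Submodule.mem_inf.mpr ⟨hw, mem_hyperplane.mpr hwj⟩)
  have hnz : (⟨direction j₁ b₁, hv₁⟩ : ↥(resVertex s ⊓ hyperplane j₀)) ≠ 0 :=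
    fun h => Directrix.direction_ne_zero j₁ b₁ (congrArg Subtype.val h)
  have hL1 : Module.finrank K ↥(resVertex s ⊓ hyperplane j₀) = 1 := by
    by_contra hne
    have h0 : resVertex s ⊓ hyperplane j₀ = ⊥ := Submodule.finrank_eq_zero.mp (by omega)
    have hv₁' := hv₁
    rw [h0, Submodule.mem_bot] at hv₁'
    exact Directrix.direction_ne_zero j₁ b₁ hv₁'
  obtain ⟨c, hc⟩ := (finrank_eq_one_iff_of_nonzero' _ hnz).mp hL1 ⟨w, hwL⟩
  exact ⟨c, (congrArg Subtype.val hc).symm⟩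

/-- **(NO-YOUNG-CORNER)** — `e_G(s₀) ≤ 2`, three consecutive shade-keeping band steps, step 1 a satellite of step 0
and step 2 a satellite of step 1: then `(v₂)_{j₀} ≠ 0` — the fourth centre is OFF the strict transform of `E₀`; two
consecutive satellite steps lose the grandparent exceptional divisor. [OURS]
[cite: CossartJannsenSaito2020, Thm. 3.10(4), Thm. 3.14, Thm. 9.3] -/
theorem direction_apply_ne_zero_of_satellite_satellite {q : ℕ} {j₀ j₁ j₂ : Fin 4} {b₀ b₁ b₂ : Fin 4 → K}
    (hb₀ : b₀ j₀ = 0) (hb₁ : b₁ j₁ = 0) (hb₂ : b₂ j₂ = 0) {s : State K} {o₀ o₁ o₂ : ℕ}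
    (ho₀ : ordZero s.F = o₀) (hr₀ : ∀ d ∈ s.F.support, s.r ≤ d) (hqo₀ : q < o₀) (ho₀2 : o₀ < 2 * q)
    (heq₀ : (CentreBlowup.step q Finset.univ j₀ b₀ s).shade = s.shade)
    (ho₁ : ordZero (CentreBlowup.step q Finset.univ j₀ b₀ s).F = o₁)
    (hr₁ : ∀ d ∈ (CentreBlowup.step q Finset.univ j₀ b₀ s).F.support,
      (CentreBlowup.step q Finset.univ j₀ b₀ s).r ≤ d)
    (hqo₁ : q < o₁) (ho₁2 : o₁ < 2 * q)
    (heq₁ : (CentreBlowup.step q Finset.univ j₁ b₁ (CentreBlowup.step q Finset.univ j₀ b₀ s)).shade =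
      (CentreBlowup.step q Finset.univ j₀ b₀ s).shade)
    (ho₂ : ordZero (CentreBlowup.step q Finset.univ j₁ b₁ (CentreBlowup.step q Finset.univ j₀ b₀ s)).F = o₂)
    (hr₂ : ∀ d ∈ (CentreBlowup.step q Finset.univ j₁ b₁ (CentreBlowup.step q Finset.univ j₀ b₀ s)).F.support,
      (CentreBlowup.step q Finset.univ j₁ b₁ (CentreBlowup.step q Finset.univ j₀ b₀ s)).r ≤ d)
    (hqo₂ : q < o₂) (ho₂2 : o₂ < 2 * q)
    (heq₂ : (CentreBlowup.step q Finset.univ j₂ b₂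
        (CentreBlowup.step q Finset.univ j₁ b₁ (CentreBlowup.step q Finset.univ j₀ b₀ s))).shade =
      (CentreBlowup.step q Finset.univ j₁ b₁ (CentreBlowup.step q Finset.univ j₀ b₀ s)).shade)
    (hsat₁ : j₁ ≠ j₀ ∧ b₁ j₀ = 0) (hsat₂ : j₂ ≠ j₁ ∧ b₂ j₁ = 0)
    (he : Module.finrank K (resVertex s) ≤ 2) : direction j₂ b₂ j₀ ≠ 0 := by
  intro h0
  -- `v₂ ∈ V₂ ∩ H_{j₁} ⊆ V₁` (SAT-LOCATED at the second step); with `(v₂)_{j₀} = 0` it is a multiple of `v₁`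
  have hv₂ : direction j₂ b₂ ∈ resVertex (CentreBlowup.step q Finset.univ j₀ b₀ s) :=
    (Submodule.mem_inf.mp (direction_mem_resVertex_of_satellite hb₁ hb₂ ho₁ hr₁ hqo₁ ho₁2 heq₁ ho₂ hr₂ hqo₂
      ho₂2 heq₂ hsat₂)).1
  obtain ⟨c, hc⟩ := eq_smul_direction_of_mem_resVertex_step hb₀ hb₁ ho₀ hr₀ hqo₀ ho₀2 heq₀ ho₁ hr₁ hqo₁ ho₁2
    heq₁ hsat₁ he hv₂ h0
  -- read the `j₁`-coordinate: `0 = (v₂)_{j₁} = c · (v₁)_{j₁} = c`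
  have h1 := congr_fun hc j₁
  rw [direction_apply_of_ne (Ne.symm hsat₂.1), hsat₂.2, Pi.smul_apply, direction_apply_self, smul_eq_mul, mul_one] at h1
  -- so `v₂ = 0`, absurd
  rw [← h1, zero_smul] at hc
  exact Directrix.direction_ne_zero j₂ b₂ hc

/-- **(NO-YOUNG-CORNER), chart-point form**: under the same hypotheses, if the third chart is not `x_{j₀}` then the
third chart point has `(b₂)_{j₀} ≠ 0` — the component `E₀` is LOST at that step. [OURS]
[cite: CossartJannsenSaito2020, Thm. 3.14] -/
theorem apply_ne_zero_of_satellite_satellite {q : ℕ} {j₀ j₁ j₂ : Fin 4} {b₀ b₁ b₂ : Fin 4 → K}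
    (hb₀ : b₀ j₀ = 0) (hb₁ : b₁ j₁ = 0) (hb₂ : b₂ j₂ = 0) {s : State K} {o₀ o₁ o₂ : ℕ}
    (ho₀ : ordZero s.F = o₀) (hr₀ : ∀ d ∈ s.F.support, s.r ≤ d) (hqo₀ : q < o₀) (ho₀2 : o₀ < 2 * q)
    (heq₀ : (CentreBlowup.step q Finset.univ j₀ b₀ s).shade = s.shade)
    (ho₁ : ordZero (CentreBlowup.step q Finset.univ j₀ b₀ s).F = o₁)
    (hr₁ : ∀ d ∈ (CentreBlowup.step q Finset.univ j₀ b₀ s).F.support,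
      (CentreBlowup.step q Finset.univ j₀ b₀ s).r ≤ d)
    (hqo₁ : q < o₁) (ho₁2 : o₁ < 2 * q)
    (heq₁ : (CentreBlowup.step q Finset.univ j₁ b₁ (CentreBlowup.step q Finset.univ j₀ b₀ s)).shade =
      (CentreBlowup.step q Finset.univ j₀ b₀ s).shade)
    (ho₂ : ordZero (CentreBlowup.step q Finset.univ j₁ b₁ (CentreBlowup.step q Finset.univ j₀ b₀ s)).F = o₂)
    (hr₂ : ∀ d ∈ (CentreBlowup.step q Finset.univ j₁ b₁ (CentreBlowup.step q Finset.univ j₀ b₀ s)).F.support,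
      (CentreBlowup.step q Finset.univ j₁ b₁ (CentreBlowup.step q Finset.univ j₀ b₀ s)).r ≤ d)
    (hqo₂ : q < o₂) (ho₂2 : o₂ < 2 * q)
    (heq₂ : (CentreBlowup.step q Finset.univ j₂ b₂
        (CentreBlowup.step q Finset.univ j₁ b₁ (CentreBlowup.step q Finset.univ j₀ b₀ s))).shade =
      (CentreBlowup.step q Finset.univ j₁ b₁ (CentreBlowup.step q Finset.univ j₀ b₀ s)).shade)
    (hsat₁ : j₁ ≠ j₀ ∧ b₁ j₀ = 0) (hsat₂ : j₂ ≠ j₁ ∧ b₂ j₁ = 0)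
    (he : Module.finrank K (resVertex s) ≤ 2) (hj : j₂ ≠ j₀) : b₂ j₀ ≠ 0 := by
  have h := direction_apply_ne_zero_of_satellite_satellite hb₀ hb₁ hb₂ ho₀ hr₀ hqo₀ ho₀2 heq₀ ho₁ hr₁ hqo₁ ho₁2
    heq₁ ho₂ hr₂ hqo₂ ho₂2 heq₂ hsat₁ hsat₂ he
  rwa [direction_apply_of_ne (Ne.symm hj)] at h

/-- **The middle vertex is spanned by two consecutive satellite directions**: under satellite(1), satellite(2)
and `e_G(s₁) ≤ 2`, `resVertex s₁ = K • v₁ ⊔ K • v₂` — `v₁ ∈ V₁` ((VT)(i)), `v₂ ∈ V₂ ∩ H_{j₁} ⊆ V₁` (SAT-LOCATED), and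
they are independent (`(v₁)_{j₁} = 1`, `(v₂)_{j₁} = 0`, `v₂ ≠ 0`). [OURS] [cite: CossartJannsenSaito2020, Thm. 3.14] -/
theorem resVertex_step_eq_span_of_satellite_satellite {q : ℕ} {j₀ j₁ j₂ : Fin 4} {b₀ b₁ b₂ : Fin 4 → K}
    (hb₁ : b₁ j₁ = 0) (hb₂ : b₂ j₂ = 0) {s : State K} {o₁ o₂ : ℕ}
    (ho₁ : ordZero (CentreBlowup.step q Finset.univ j₀ b₀ s).F = o₁)
    (hr₁ : ∀ d ∈ (CentreBlowup.step q Finset.univ j₀ b₀ s).F.support,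
      (CentreBlowup.step q Finset.univ j₀ b₀ s).r ≤ d)
    (hqo₁ : q < o₁) (ho₁2 : o₁ < 2 * q)
    (heq₁ : (CentreBlowup.step q Finset.univ j₁ b₁ (CentreBlowup.step q Finset.univ j₀ b₀ s)).shade =
      (CentreBlowup.step q Finset.univ j₀ b₀ s).shade)
    (ho₂ : ordZero (CentreBlowup.step q Finset.univ j₁ b₁ (CentreBlowup.step q Finset.univ j₀ b₀ s)).F = o₂)
    (hr₂ : ∀ d ∈ (CentreBlowup.step q Finset.univ j₁ b₁ (CentreBlowup.step q Finset.univ j₀ b₀ s)).F.support,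
      (CentreBlowup.step q Finset.univ j₁ b₁ (CentreBlowup.step q Finset.univ j₀ b₀ s)).r ≤ d)
    (hqo₂ : q < o₂) (ho₂2 : o₂ < 2 * q)
    (heq₂ : (CentreBlowup.step q Finset.univ j₂ b₂
        (CentreBlowup.step q Finset.univ j₁ b₁ (CentreBlowup.step q Finset.univ j₀ b₀ s))).shade =
      (CentreBlowup.step q Finset.univ j₁ b₁ (CentreBlowup.step q Finset.univ j₀ b₀ s)).shade)
    (hsat₂ : j₂ ≠ j₁ ∧ b₂ j₁ = 0)
    (he₁ : Module.finrank K (resVertex (CentreBlowup.step q Finset.univ j₀ b₀ s)) ≤ 2) :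
    resVertex (CentreBlowup.step q Finset.univ j₀ b₀ s) = (K ∙ direction j₁ b₁) ⊔ (K ∙ direction j₂ b₂) := by
  have hv₁ : direction j₁ b₁ ∈ resVertex (CentreBlowup.step q Finset.univ j₀ b₀ s) :=
    direction_mem_resVertex_of_shade_eq j₁ hb₁ ho₁ hr₁ hqo₁ ho₁2 heq₁
  have hv₂' := direction_mem_resVertex_of_satellite hb₁ hb₂ ho₁ hr₁ hqo₁ ho₁2 heq₁ ho₂ hr₂ hqo₂ ho₂2 heq₂ hsat₂
  have hv₂ : direction j₂ b₂ ∈ resVertex (CentreBlowup.step q Finset.univ j₀ b₀ s) := (Submodule.mem_inf.mp hv₂').1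
  have hle : (K ∙ direction j₁ b₁) ⊔ (K ∙ direction j₂ b₂) ≤ resVertex (CentreBlowup.step q Finset.univ j₀ b₀ s) :=
    sup_le ((Submodule.span_singleton_le_iff_mem _ _).mpr hv₁) ((Submodule.span_singleton_le_iff_mem _ _).mpr hv₂)
  symm
  refine Submodule.eq_of_le_of_finrank_le hle (le_trans he₁ ?_)
  -- the span `S` has rank `≥ 2`: `v₁ ∈ S` leaves `H_{j₁}`, and `S ⊓ H_{j₁} ∋ v₂ ≠ 0`
  have h1 := finrank_inf_hyperplane_add_one ((K ∙ direction j₁ b₁) ⊔ (K ∙ direction j₂ b₂)) j₁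
    (Submodule.mem_sup_left (Submodule.mem_span_singleton_self _))
    (by rw [direction_apply_self]; exact one_ne_zero)
  have hv₂S : direction j₂ b₂ ∈ ((K ∙ direction j₁ b₁) ⊔ (K ∙ direction j₂ b₂)) ⊓ hyperplane j₁ :=
    Submodule.mem_inf.mpr ⟨Submodule.mem_sup_right (Submodule.mem_span_singleton_self _),
      (Submodule.mem_inf.mp hv₂').2⟩
  have h2 : 1 ≤ Module.finrank K ↥(((K ∙ direction j₁ b₁) ⊔ (K ∙ direction j₂ b₂)) ⊓ hyperplane j₁) := by
    by_contra hlt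
    have h0 : ((K ∙ direction j₁ b₁) ⊔ (K ∙ direction j₂ b₂)) ⊓ hyperplane j₁ = ⊥ :=
      Submodule.finrank_eq_zero.mp (by omega)
    rw [h0, Submodule.mem_bot] at hv₂S
    exact Directrix.direction_ne_zero j₂ b₂ hv₂S
  omega

end YoungBoundary

end ResCone

end Summit.ResolutionOfSingularities.ResolutionOfSingularities.Theorems.PIDim4

end
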